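import Literature.NumberTheory.LFunctions.GeneralizedBernoulliNumbers
import Mathlib.NumberTheory.DirichletCharacter.GaussSum
import Mathlib.Analysis.SpecialFunctions.Trigonometric.Cotangent
import Mathlib.Analysis.SpecialFunctions.Complex.CircleAddChar
import HarnessLib

/-!
# The cotangent character sum `∑_{x mod m} θ(x) π cot(π x/m) = 2πi τ(θ) B_{1,θ̄}`

Topic `Literature/NumberTheory/LFunctions`; namespace `Literature.NumberTheory.LFunctions`.
THEOREMS only: no definition, no named fact.

For a primitive Dirichlet character `θ` modulo `m ≠ 1` with complex values,

  `∑_{x ∈ ℤ/m} θ(x) · π cot(π x̃ / m) = 2πi · τ(θ) · B_{1,θ̄}`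
  (`sum_mul_pi_mul_cot_eq_gaussSum_mul_bernoulli`),

where `x̃ ∈ {0, …, m - 1}` is the representative (`ZMod.val`; the term `x = 0` vanishes since
`θ(0) = 0`, and Lean's `cot 0 = 0` anyway), `τ(θ) = ∑_a θ(a) e(a/m)` is the Gauss sum (Mathlib
`gaussSum θ ZMod.stdAddChar`) and `B_{1,θ̄} = ∑_j θ̄(j) (j̃/m - 1/2)` is the first generalized
Bernoulli number (the tree's `generalizedBernoulli 1 θ⁻¹`, Diamond–Shurman (4.30)).

This is the finite identity inside Lang's evaluation `L(1, χ) = πi S(χ) B_{1,χ̄} / m` of the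
`L`-series of an odd primitive character (`S(χ) = τ(χ)`; Cyclotomic Fields I, Ch. 3, §2,
Thm. 2.2 and the displayed formula of Case 2), through `L(1, χ) = (π/2m) ∑_b χ(b) cot(πb/m)`;
in the tree it evaluates the constant terms at the cusps of the weight-one Eisenstein series
with two characters (the limits `π cot(π x/N)` at `i∞` of the weight-one division values
`ζ(x/N; Λ_τ) - (x/N) G₂(τ)`, file `EllipticCurves/EisensteinSeriesTwoCharacterWeightOneCusps`).
The proof is the printed bookkeeping made finite: the finite Fourier expansion of the
cotangent at a non-trivial `m`-th root of unity `w = e(x̃/m)`,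

  `π cot(π x̃/m) = πi (w + 1)/(w - 1) = πi + (2πi/m) ∑_{j<m} j wʲ`

(`sub_one_mul_sum_range_mul_pow`: `(w - 1) ∑_{j<m} j wʲ = m`, telescoping against
`∑_{j<m} wʲ = 0`), then `∑_x θ(x) e(jx/m) = θ̄(j) τ(θ)` (Mathlib
`gaussSum_mulShift_of_isPrimitive`), `∑_x θ(x) = 0` and `∑_j θ̄(j) = 0`, which turn
`(2πi/m) τ(θ) ∑_{j<m} j θ̄(j)` into `2πi τ(θ) B_{1,θ̄}`.

## References

* S. Lang, *Cyclotomic Fields I and II*, GTM 121 (1990), Ch. 3, §2, Thm. 2.2 and Case 2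
  (`χ` odd): `L(1,χ) = (πi S(χ)/m) ∑_{b=1}^{m-1} χ̄(b) (b/m - 1/2) = πi S(χ) B_{1,χ̄}/m`.
  [Lang1990]
* F. Diamond, J. Shurman, *A First Course in Modular Forms*, GTM 228 (2005), §4.7 (4.30),
  §4.8. [DiamondShurman2005]
-/

noncomputable section

open Finset Complex DirichletCharacter

open scoped Real

namespace Literature.NumberTheory.LFunctions

/-- **Finite Fourier expansion of `1/(w - 1)`**: for an `m`-th root of unity `w ≠ 1`,
`(w - 1) ∑_{j<m} j wʲ = m` (multiply `S = ∑ j wʲ` by `w`, shift the index and use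
`∑_{j<m} wʲ = 0`). [folklore] -/
theorem sub_one_mul_sum_range_mul_pow {w : ℂ} {m : ℕ} (hw : w ^ m = 1) (hw1 : w ≠ 1) :
    (w - 1) * ∑ j ∈ range m, (j : ℂ) * w ^ j = m := by
  have hgeom : ∑ j ∈ range m, w ^ j = 0 := by
    have h := geom_sum_mul w m
    rw [hw, sub_self] at h
    exact (mul_eq_zero.mp h).resolve_right (sub_ne_zero.mpr hw1)
  -- `∑_{j ≤ m} j wʲ` computed in two ways
  have h1 : ∑ j ∈ range (m + 1), (j : ℂ) * w ^ j = ∑ j ∈ range m, (j : ℂ) * w ^ j + m :=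
    by rw [Finset.sum_range_succ, hw, mul_one]
  have h2 : ∑ j ∈ range (m + 1), (j : ℂ) * w ^ j =
      ∑ j ∈ range m, ((j + 1 : ℕ) : ℂ) * w ^ (j + 1) := by
    rw [Finset.sum_range_succ', Nat.cast_zero, zero_mul, add_zero]
  have h3 : ∑ j ∈ range m, ((j + 1 : ℕ) : ℂ) * w ^ (j + 1) =
      w * ∑ j ∈ range m, (j : ℂ) * w ^ j + w * ∑ j ∈ range m, w ^ j := by
    rw [Finset.mul_sum, Finset.mul_sum, ← Finset.sum_add_distrib]
    refine Finset.sum_congr rfl fun j _ ↦ ?_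
    push_cast
    ring
  rw [hgeom, mul_zero, add_zero] at h3
  linear_combination (-1 : ℂ) * ((h2.symm.trans h1).symm.trans h3)

/-- The algebra of the cotangent at a root of unity: if `(w - 1) S = m` then
`m (w + 1)/(i (1 - w)) = i (m + 2S)`. [folklore] -/
theorem mul_cot_ratio_eq {w S m : ℂ} (hw1 : w ≠ 1) (hS : (w - 1) * S = m) :
    m * ((w + 1) / (I * (1 - w))) = I * (m + 2 * S) := by
  have h1w : (1 - w) ≠ 0 := sub_ne_zero.mpr (Ne.symm hw1)
  rw [← mul_div_assoc, div_eq_iff (mul_ne_zero I_ne_zero h1w)]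
  linear_combination (-(m + 2 * S) * (1 - w)) * I_sq + (-2 : ℂ) * hS

/-- `∑_{x ∈ ℤ/m} F(x̃) = ∑_{n < m} F(n)` through the representatives `x̃ ∈ [0, m)`. [folklore] -/
theorem sum_zmod_val_eq_sum_range {M : Type*} [AddCommMonoid M] {m : ℕ} [NeZero m]
    (F : ℕ → M) : ∑ x : ZMod m, F x.val = ∑ n ∈ range m, F n := by
  refine Finset.sum_nbij ZMod.val (fun x _ ↦ mem_range.2 (ZMod.val_lt x)) ?_ ?_ (fun _ _ ↦ rfl)
  · exact fun x _ y _ h ↦ ZMod.val_injective m h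
  · intro n hn
    exact ⟨(n : ZMod m), by simp, ZMod.val_cast_of_lt (mem_range.1 hn)⟩

/-- **The finite Fourier expansion of the cotangent**: for `x ≢ 0 (mod m)`,
`m · π cot(π x̃/m) = πi (m + 2 ∑_{j<m} j e(j x/m))`. [cite: Lang1990, Ch. 3 §2 (Case 2)] -/
theorem natCast_mul_pi_mul_cot_eq {m : ℕ} [NeZero m] {x : ZMod m} (hx : x ≠ 0) :
    (m : ℂ) * (π * Complex.cot (π * (((x.val : ℕ) : ℂ) / m))) =
      π * I * (m + 2 * ∑ j ∈ range m, (j : ℂ) * ZMod.stdAddChar ((j : ZMod m) * x)) := by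
  set w : ℂ := ZMod.stdAddChar x with hw
  have hwj : ∀ j : ℕ, (ZMod.stdAddChar ((j : ZMod m) * x) : ℂ) = w ^ j := fun j ↦ by
    rw [hw, ← AddChar.map_nsmul_eq_pow, nsmul_eq_mul]
  have hwm : w ^ m = 1 := by
    rw [← hwj, ZMod.natCast_self, zero_mul, AddChar.map_zero_eq_one]
  have hw1 : w ≠ 1 := by
    intro h1
    apply hx
    apply ZMod.injective_stdAddChar (N := m)
    have : (ZMod.stdAddChar x : ℂ) = 1 := by rw [← hw]; exact h1
    rw [this, AddChar.map_zero_eq_one]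
  have hS := sub_one_mul_sum_range_mul_pow hwm hw1
  simp_rw [hwj]
  have hz : Complex.cot (π * (((x.val : ℕ) : ℂ) / m)) = (w + 1) / (I * (1 - w)) := by
    rw [Complex.cot_pi_eq_exp_ratio]
    have : Complex.exp (2 * π * I * (((x.val : ℕ) : ℂ) / m)) = w := by
      rw [hw, ZMod.stdAddChar_apply, ZMod.toCircle_apply]
      congr 1
      ring
    rw [this]
  rw [hz, mul_left_comm, mul_cot_ratio_eq hw1 hS, mul_assoc]

/-- **`∑_{x mod m} θ(x) π cot(π x̃/m) = 2πi τ(θ) B_{1,θ̄}`** for a primitive Dirichlet character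
`θ` modulo `m ≠ 1` (`τ(θ)` the Gauss sum for `e(·/m)`, `B_{1,θ̄} = ∑_j θ̄(j)(j̃/m - 1/2)`).
[cite: Lang1990, Ch. 3 §2, Thm. 2.2 and Case 2] -/
theorem sum_mul_pi_mul_cot_eq_gaussSum_mul_bernoulli {m : ℕ} [NeZero m]
    (θ : DirichletCharacter ℂ m) (hθ : θ.IsPrimitive) (hm : m ≠ 1) :
    ∑ x : ZMod m, θ x * (π * Complex.cot (π * (((x.val : ℕ) : ℂ) / m))) =
      2 * π * I * gaussSum θ (ZMod.stdAddChar (N := m)) * generalizedBernoulli 1 θ⁻¹ := by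
  -- `θ ≠ 1`, `θ(0) = 0`
  have hθ1 : θ ≠ 1 := by
    intro h
    have h1 : θ.conductor = m := hθ
    rw [h, DirichletCharacter.conductor_one] at h1
    exact hm h1.symm
  have hθ1' : θ⁻¹ ≠ 1 := by rwa [Ne, inv_eq_one]
  have hm0 : (m : ℂ) ≠ 0 := by exact_mod_cast NeZero.ne m
  have hθ0 : θ 0 = 0 := by
    have : Fact (1 < m) := ⟨lt_of_le_of_ne NeZero.one_le (Ne.symm hm)⟩
    exact MulChar.map_nonunit θ (by rw [isUnit_zero_iff]; exact zero_ne_one)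
  -- the Gauss sums `∑_x θ(x) e(jx/m) = θ̄(j) τ(θ)`
  have hgauss : ∀ j : ℕ, ∑ x : ZMod m, θ x * ZMod.stdAddChar ((j : ZMod m) * x) =
      θ⁻¹ (j : ZMod m) * gaussSum θ (ZMod.stdAddChar (N := m)) := by
    intro j
    rw [← gaussSum_mulShift_of_isPrimitive _ hθ, gaussSum]
    refine Finset.sum_congr rfl fun x _ ↦ ?_
    rw [AddChar.mulShift_apply]
  have hT : ∑ x : ZMod m, θ x * ∑ j ∈ range m, (j : ℂ) * ZMod.stdAddChar ((j : ZMod m) * x) =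
      gaussSum θ (ZMod.stdAddChar (N := m)) * ∑ j ∈ range m, (j : ℂ) * θ⁻¹ (j : ZMod m) := by
    simp_rw [Finset.mul_sum]
    rw [Finset.sum_comm]
    refine Finset.sum_congr rfl fun j _ ↦ ?_
    have : ∑ x : ZMod m, θ x * ((j : ℂ) * ZMod.stdAddChar ((j : ZMod m) * x)) =
        (j : ℂ) * ∑ x : ZMod m, θ x * ZMod.stdAddChar ((j : ZMod m) * x) := by
      rw [Finset.mul_sum]
      exact Finset.sum_congr rfl fun x _ ↦ by ring
    rw [this, hgauss j]
    ring
  -- `m ·` (left side) `= 2πi τ(θ) ∑_{j<m} j θ̄(j)`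
  have hleft : (m : ℂ) * ∑ x : ZMod m, θ x * (π * Complex.cot (π * (((x.val : ℕ) : ℂ) / m))) =
      2 * π * I * gaussSum θ (ZMod.stdAddChar (N := m)) *
        ∑ j ∈ range m, (j : ℂ) * θ⁻¹ (j : ZMod m) := by
    have hx : ∀ x : ZMod m, (m : ℂ) * (θ x * (π * Complex.cot (π * (((x.val : ℕ) : ℂ) / m)))) =
        π * I * m * θ x +
          2 * π * I * (θ x * ∑ j ∈ range m, (j : ℂ) * ZMod.stdAddChar ((j : ZMod m) * x)) := by
      intro x
      by_cases h0 : x = 0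
      · rw [h0, hθ0]; ring
      · rw [mul_left_comm, natCast_mul_pi_mul_cot_eq h0]; ring
    rw [Finset.mul_sum, Finset.sum_congr rfl fun x _ ↦ hx x, Finset.sum_add_distrib,
      ← Finset.mul_sum, ← Finset.mul_sum, MulChar.sum_eq_zero_of_ne_one hθ1, mul_zero, zero_add,
      hT]
    ring
  -- `m B_{1,θ̄} = ∑_{j<m} j θ̄(j)`
  have hB : (m : ℂ) * generalizedBernoulli 1 θ⁻¹ = ∑ j ∈ range m, (j : ℂ) * θ⁻¹ (j : ZMod m) := by
    have hcoeff : ∀ c : ℕ, (m : ℂ) * algebraMap ℚ ℂ (genBernoulliCoeff 1 m c) = c - m / 2 := by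
      intro c
      rw [genBernoulliCoeff_of_one_le le_rfl, Polynomial.bernoulli_one, eq_ratCast]
      simp only [Nat.sub_self, pow_zero, one_mul, Polynomial.eval_sub, Polynomial.eval_X,
        Polynomial.eval_C]
      push_cast
      field_simp
    have hrange : ∑ j : ZMod m, ((j.val : ℕ) : ℂ) * θ⁻¹ j =
        ∑ j ∈ range m, (j : ℂ) * θ⁻¹ (j : ZMod m) := by
      rw [← sum_zmod_val_eq_sum_range (fun n ↦ (n : ℂ) * θ⁻¹ (n : ZMod m))]
      refine Finset.sum_congr rfl fun j _ ↦ ?_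
      rw [ZMod.natCast_zmod_val]
    rw [generalizedBernoulli_eq_sum, Finset.mul_sum, ← hrange]
    calc ∑ j : ZMod m, (m : ℂ) * (θ⁻¹ j * algebraMap ℚ ℂ (genBernoulliCoeff 1 m j.val))
        = ∑ j : ZMod m, (((j.val : ℕ) : ℂ) * θ⁻¹ j - (m / 2) * θ⁻¹ j) := by
          refine Finset.sum_congr rfl fun j _ ↦ ?_
          rw [mul_left_comm, hcoeff]
          ring
      _ = ∑ j : ZMod m, ((j.val : ℕ) : ℂ) * θ⁻¹ j := by
          rw [Finset.sum_sub_distrib, ← Finset.mul_sum, MulChar.sum_eq_zero_of_ne_one hθ1',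
            mul_zero, sub_zero]
  -- cancel `m`
  apply mul_left_cancel₀ hm0
  rw [hleft, show (m : ℂ) * (2 * π * I * gaussSum θ (ZMod.stdAddChar (N := m)) *
      generalizedBernoulli 1 θ⁻¹) = 2 * π * I * gaussSum θ (ZMod.stdAddChar (N := m)) *
        ((m : ℂ) * generalizedBernoulli 1 θ⁻¹) by ring, hB]

end Literature.NumberTheory.LFunctions
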